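import Summits.FinalStateConjecture.FinalStateConjecture.Theorems.PhotonSphereChannelsTameCensorshipExactKerrCharts
import HarnessLib

/-!
# Crux `TameCensorship` (stmt-FinalStateConjecture-10047), line `crush-the-swallowed-interior`,
# stub B `stub_exactKerrBookkeeping`: conjunct B4 — the visible points of the exact part carry
# uniform tame charts — from the Kerr facts read through an exact-Kerr chart

For a Cauchy development `𝒟 = (M, g, τ, ι, ν)` of a Kerr-shielded datum (`φ : Kerr.slice a r₁ → X`,
core `K = (range φ)ᶜ`, exact part `E = J⁺(ιX) ∖ J⁺(ιK)`), a collar chart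
`χ' : Kerr.region a r₁ → M` (smooth isometric open embedding on the tapered collar
`C = {0 < x⁰ − T(r x) + (r x − r₁)/4}`, anchored on the leaf: `χ' ∘ ψ = ι ∘ φ`) and an exact-Kerr
chart `χ : M → Kerr.region a r₋` on an open `E' ⊇ E` (smooth, injective, isometric,
time-orientation preserving, inverting `χ'` on `C` — the content of the named fact
`KerrLeafExactPartChart` of `Literature/Geometry/Lorentzian/KerrExactRegionFacts.lean`), the main
theorem `ballChart_or_swallowed_of_exactKerrChart` derives conjunct (B4) of stub B at one scale
`r'` from two Kerr facts read in the chart `{r > r₋}` — (F4a) no future-complete null geodesic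
meets `{r < r₊}` (`KerrBlackHoleNoCompleteNullRay`) and (F4) uniform framed Kerr–Schild balls at
the visible points above the leaf (`KerrVisibleExteriorUniformCharts`): every `q ∈ J⁺(ιX)` in the
chronological past of the future half of a future-complete normalised null ray from the data
either sees that half meet `J⁺(ιK)`, or carries a late chart of the Minkowski background on
`B(0, r')` centred at `q` with the bounds of (F4).

Proof: if the half-ray avoids `J⁺(ιK)` then `q ∈ E` and the half-ray lies in `E` (causal
convexity, `curve_mem_exactPart`); a future null velocity propagates along the geodesic
(`isNull_and_isFutureDirected_velocity`), `χ` carries the ray to a Kerr geodesic on `(0, ∞)`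
(`isGeodesicOn_comp_of_chart`) with future null velocity, so (F4a) puts `γ(t₁) ≫ q` at
`r ≥ r₊`; `χ` carries the causal curve from the leaf to `q` and the timelike curve from `q` to
`γ(t₁)` into the Kerr chart (`mem_causalFuture_comp_of_chart`,
`mem_chronologicalFuture_comp_of_chart`), so (F4) frames a ball at `x = χ q` inside the collar;
the chart is `χ' ∘ (x + A ·)` (`exists_lateChart_of_frame`), centred at `χ'(χ q) = q` by
injectivity of `χ` on `E'`.

References: O'Neill 1995, Ch. 2, §2.5, Ch. 4, §4.3; O'Neill 1983, Ch. 14, pp. 402–409;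
Dafermos–Holzegel–Rodnianski–Taylor arXiv:2104.08222, §1.
-/

set_option linter.dupNamespace false

noncomputable section

open scoped Manifold ContDiff Topology ENNReal NNReal
open Set Filter Bundle Function Topology
open Literature.Geometry.Lorentzian

namespace Summit.FinalStateConjecture.FinalStateConjecture.Theorems.PhotonSphereChannels.TameCensorshipCrush

/-! ## The future half of a future-complete normalised null ray -/

section Ray

/-- **The future half of a future-complete normalised null ray is a future causal geodesic ray.**
For a normalised null ray `γ` from the data hypersurface of a Cauchy development with affine
domain `dom` unbounded above: `[0, ∞) ⊆ dom`, `γ` is a future causal curve on `dom`, and its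
velocity is null and future-directed throughout `dom` (`g(γ', γ')` is constant along a geodesic,
`γ'` vanishes nowhere, and the sign of `g(τ, γ')` cannot change: the tree's
`IsGeodesicOn.isNull_and_isFutureDirected_velocity`). O'Neill 1983, Ch. 3, p. 69 and Ch. 5,
Lemma 5.26. [cite: ONeillSemiRiemannian1983, Ch. 3, p. 69 and Ch. 5, Lemma 5.26 (p. 141)] -/
theorem normalisedNullRay_future_half {X : Type} [TopologicalSpace X] [ChartedSpace E3 X]
    [IsManifold (𝓡 3) ((⊤ : ℕ∞) : WithTop ℕ∞) X] [ConnectedSpace X]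
    {D : InitialDataSet (𝓡 3) X} (𝒟 : CauchyDevelopment D) [𝒟.metric.HasLeviCivita]
    {p : X} {γ : ℝ → 𝒟.carrier} {dom : Set ℝ}
    (hray : 𝒟.metric.IsNormalisedNullRayFrom 𝒟.timeOrientation 𝒟.embed 𝒟.normal p γ dom)
    (hdom : ¬ BddAbove dom) :
    (∀ t : ℝ, 0 ≤ t → t ∈ dom) ∧ 𝒟.metric.IsFutureCausalCurveOn 𝒟.timeOrientation γ dom ∧
      ∀ t ∈ dom, 𝒟.metric.IsNull (velocity (𝓡 4) γ t) ∧
        𝒟.timeOrientation.IsFutureDirected (velocity (𝓡 4) γ t) := by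
  obtain ⟨hmax, h0dom, -, hnull0, hfut0, -⟩ := hray
  have hopen : IsOpen dom := hmax.isOpen
  have hoc : dom.OrdConnected := hmax.2.1
  have hgeo : IsGeodesicOn 𝒟.metric.leviCivita γ dom := hmax.isGeodesicOn
  have hIci : ∀ t : ℝ, 0 ≤ t → t ∈ dom := fun t ht ↦ by
    obtain ⟨t', ht', htt'⟩ := not_bddAbove_iff.1 hdom t
    exact hoc.out h0dom ht' ⟨ht, htt'.le⟩
  have hn1 : (1 : ℕ∞ω) ≤ ((⊤ : ℕ∞) : WithTop ℕ∞) := by exact_mod_cast le_top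
  haveI : Fact ((1 : ℕ∞ω) ≤ ((⊤ : ℕ∞) : WithTop ℕ∞)) := ⟨hn1⟩
  haveI : CovariantDerivative.ContMDiffCovariantDerivative 𝒟.metric.leviCivita 1 :=
    ⟨𝒟.metric.toPseudoRiemannianMetric.isLocallyContMDiff_leviCivita_holds 1
      (by rw [show ((1 : ℕ∞) : ℕ∞ω) + 1 = 2 by norm_num]; exact WithTop.coe_le_coe.2 le_top)
      univ isOpen_univ⟩
  have hvel : ∀ t ∈ dom, 𝒟.metric.IsNull (velocity (𝓡 4) γ t) ∧
      𝒟.timeOrientation.IsFutureDirected (velocity (𝓡 4) γ t) := fun t ht ↦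
    hgeo.isNull_and_isFutureDirected_velocity 𝒟.metric 𝒟.timeOrientation hopen hoc h0dom
      hnull0 hfut0 ht
  exact ⟨hIci, fun t ht ↦ ⟨IsGeodesicOn.mdifferentiableAt_holds hgeo ht, (hvel t ht).2⟩, hvel⟩

end Ray

/-! ## (B4) Visible points of the exact part carry uniform tame charts -/

section Visible

/-- **(B4) from the Kerr facts.** Let `𝒟` be a Cauchy development of data on `X` with Levi-Civita
connection, `φ : Kerr.slice a r₁ → X`, `K = (range φ)ᶜ`, `E = J⁺(ιX) ∖ J⁺(ιK)`; let
`χ' : Kerr.region a r₁ → M` be a collar chart (smooth, open embedding and isometric on the open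
collar `C = {0 < x⁰ − T(r x) + (r x − r₁)/4}`, with `χ' ∘ ψ = ι ∘ φ` for the leaf `ψ`, a graph of
`T∘r` over `{r > r₁}` lying in `C`), and `χ : M → Kerr.region a r₋` an exact-Kerr chart on an open
`E' ⊇ E` (smooth, injective, isometric, time-orientation preserving, inverting `χ'` on `C`). Assume
the two Kerr facts, read in the chart `{r > r₋}`: (F4a) no geodesic on a parameter ray `(t₀, ∞)`
has a future null velocity at a point with `r < r₊`; (F4) at scale `r'`, every point `x` in the
causal future of the leaf whose chronological future reaches `{r ≥ r₊}` admits a frame `A` with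
`x + A(B(0, r')) ⊆ C` and Kerr–Schild deviation bounds `Λ` (`C³`) and `1/2` (`C⁰`). Then for every
`q ∈ J⁺(ιX)` in the chronological past of the future half of a future-complete normalised null
ray `γ` from the data: either that half meets `J⁺(ιK)`, or `q` carries a late chart of the
Minkowski background on `B(0, r')` centred at `q` with those bounds. Proof: if the half-ray avoids
`J⁺(ιK)` then `q ∈ E` and `γ(t) ∈ E` for `t ≥ 0` (causal convexity); `χ ∘ γ` is a Kerr geodesic
on `(0, ∞)` with future null velocity (`isGeodesicOn_comp_of_chart`,
`isNull_and_isFutureDirected_velocity`), so by (F4a) the point `γ(t₁) ≫ q` has `r ≥ r₊`; the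
causal curve from the leaf to `q` and the timelike curve from `q` to `γ(t₁)` stay in `E` and are
carried by `χ` into the Kerr chart, so (F4) applies at `x = χ q`; the chart is
`χ' ∘ (x + A ·)` (`exists_lateChart_of_frame`), centred at `χ'(χ q) = q` by injectivity of `χ`.
[cite: ONeill1995, Ch. 2, §2.5 and Ch. 4, §4.3] [cite: arXiv210408222, §1] -/
theorem ballChart_or_swallowed_of_exactKerrChart {X : Type} [TopologicalSpace X]
    [ChartedSpace E3 X] [IsManifold (𝓡 3) ((⊤ : ℕ∞) : WithTop ℕ∞) X] [ConnectedSpace X]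
    {D : InitialDataSet (𝓡 3) X} [Kerr.Facts] (𝒟 : CauchyDevelopment D)
    [𝒟.metric.HasLeviCivita] {M a r₁ : ℝ} (hM : 0 ≤ M)
    [(Kerr.spacetime M a (Kerr.rMinus M a) hM).metric.HasLeviCivita]
    {T : ℝ → ℝ} {φ : Kerr.slice a r₁ → X} {ψ : Kerr.slice a r₁ → Kerr.region a r₁}
    (hψr : ∀ y, r₁ < Kerr.radius a (ψ y : E4))
    (hψT : ∀ y, (ψ y : E4) 0 = T (Kerr.radius a (ψ y : E4)))
    (hψC : ∀ y, 0 < (ψ y : E4) 0 - T (Kerr.radius a (ψ y : E4)) + (Kerr.radius a (ψ y : E4) - r₁) / 4)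
    {χ' : Kerr.region a r₁ → 𝒟.carrier}
    (hCo : IsOpen {x : Kerr.region a r₁ |
      0 < (x : E4) 0 - T (Kerr.radius a (x : E4)) + (Kerr.radius a (x : E4) - r₁) / 4})
    (hχ's : ContMDiffOn 𝓘(ℝ, E4) (𝓡 4) ((⊤ : ℕ∞) : WithTop ℕ∞) χ'
      {x | 0 < (x : E4) 0 - T (Kerr.radius a (x : E4)) + (Kerr.radius a (x : E4) - r₁) / 4})
    (hχ'o : Topology.IsOpenEmbedding (Set.restrict {x : Kerr.region a r₁ |
      0 < (x : E4) 0 - T (Kerr.radius a (x : E4)) + (Kerr.radius a (x : E4) - r₁) / 4} χ'))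
    (hχ'g : ∀ x : Kerr.region a r₁,
      0 < (x : E4) 0 - T (Kerr.radius a (x : E4)) + (Kerr.radius a (x : E4) - r₁) / 4 →
      ∀ v w : E4, 𝒟.metric.val (χ' x) (mfderiv 𝓘(ℝ, E4) (𝓡 4) χ' x v)
        (mfderiv 𝓘(ℝ, E4) (𝓡 4) χ' x w) = Kerr.bilin M a (x : E4) v w)
    (hχ'ψ : ∀ y : Kerr.slice a r₁, χ' (ψ y) = 𝒟.embed (φ y))
    {E' : Set 𝒟.carrier} {χ : 𝒟.carrier → Kerr.region a (Kerr.rMinus M a)}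
    (hEE' : 𝒟.metric.causalFuture 𝒟.timeOrientation (Set.range 𝒟.embed) \
        𝒟.metric.causalFuture 𝒟.timeOrientation (𝒟.embed '' (Set.range φ)ᶜ) ⊆ E')
    (hE'o : IsOpen E') (hχs : ContMDiffOn (𝓡 4) (𝓡 4) ((⊤ : ℕ∞) : WithTop ℕ∞) χ E')
    (hχi : Set.InjOn χ E')
    (hχg : ∀ p ∈ E', (∀ v w, Kerr.bilin M a (χ p : E4) (mfderiv (𝓡 4) (𝓡 4) χ p v)
        (mfderiv (𝓡 4) (𝓡 4) χ p w) = 𝒟.metric.val p v w) ∧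
      (Kerr.spacetime M a (Kerr.rMinus M a) hM).timeOrientation.IsFutureDirected
        (mfderiv (𝓡 4) (𝓡 4) χ p (𝒟.timeOrientation.vectorField p)))
    (hχW : ∀ x : Kerr.region a r₁,
      0 < (x : E4) 0 - T (Kerr.radius a (x : E4)) + (Kerr.radius a (x : E4) - r₁) / 4 →
      χ' x ∈ E' ∧ (χ (χ' x) : E4) = (x : E4))
    (hF4a : ∀ (β : ℝ → Kerr.region a (Kerr.rMinus M a)) (t₀ t₁ : ℝ), t₀ < t₁ →
      IsGeodesicOn (Kerr.spacetime M a (Kerr.rMinus M a) hM).metric.leviCivita β (Set.Ioi t₀) →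
      (Kerr.spacetime M a (Kerr.rMinus M a) hM).metric.IsNull (velocity (𝓡 4) β t₁) →
      (Kerr.spacetime M a (Kerr.rMinus M a) hM).timeOrientation.IsFutureDirected
        (velocity (𝓡 4) β t₁) →
      Kerr.rPlus M a ≤ Kerr.radius a (β t₁ : E4))
    {r' : ℝ} (hr' : 0 < r') {Λ : ℝ≥0}
    (hF4 : ∀ x z : Kerr.region a (Kerr.rMinus M a),
      x ∈ (Kerr.spacetime M a (Kerr.rMinus M a) hM).metric.causalFuture
          (Kerr.spacetime M a (Kerr.rMinus M a) hM).timeOrientation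
          {y : Kerr.region a (Kerr.rMinus M a) |
            r₁ < Kerr.radius a (y : E4) ∧ (y : E4) 0 = T (Kerr.radius a (y : E4))} →
      z ∈ (Kerr.spacetime M a (Kerr.rMinus M a) hM).metric.chronologicalFuture
          (Kerr.spacetime M a (Kerr.rMinus M a) hM).timeOrientation {x} →
      Kerr.rPlus M a ≤ Kerr.radius a (z : E4) →
      ∃ A : E4 ≃L[ℝ] E4,
        (∀ y ∈ Metric.ball (0 : E4) r',
          max r₁ 0 < Kerr.radius a ((x : E4) + A y) ∧
          0 < ((x : E4) + A y) 0 - T (Kerr.radius a ((x : E4) + A y)) +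
            (Kerr.radius a ((x : E4) + A y) - r₁) / 4) ∧
        supCkENorm (Metric.ball (0 : E4) r') 3
          (Function.extend
            (Subtype.val : (⟨Metric.ball (0 : E4) r', Metric.isOpen_ball⟩ :
              TopologicalSpace.Opens E4) → E4)
            (fun y ↦ (Kerr.bilin M a ((x : E4) + A (y : E4))).bilinearComp
              (A : E4 →L[ℝ] E4) (A : E4 →L[ℝ] E4) - Minkowski.bilin) 0) ≤ (Λ : ℝ≥0∞) ∧
        supCkENorm (Metric.ball (0 : E4) r') 0
          (Function.extend
            (Subtype.val : (⟨Metric.ball (0 : E4) r', Metric.isOpen_ball⟩ :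
              TopologicalSpace.Opens E4) → E4)
            (fun y ↦ (Kerr.bilin M a ((x : E4) + A (y : E4))).bilinearComp
              (A : E4 →L[ℝ] E4) (A : E4 →L[ℝ] E4) - Minkowski.bilin) 0) ≤ 1 / 2)
    {q : 𝒟.carrier} (hq : q ∈ 𝒟.metric.causalFuture 𝒟.timeOrientation (Set.range 𝒟.embed))
    {p : X} {γ : ℝ → 𝒟.carrier} {dom : Set ℝ}
    (hray : 𝒟.metric.IsNormalisedNullRayFrom 𝒟.timeOrientation 𝒟.embed 𝒟.normal p γ dom)
    (hdom : ¬ BddAbove dom)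
    (hqI : q ∈ 𝒟.metric.chronologicalPast 𝒟.timeOrientation (γ '' (dom ∩ Set.Ici 0))) :
    (γ '' (dom ∩ Set.Ici 0) ∩
        𝒟.metric.causalFuture 𝒟.timeOrientation (𝒟.embed '' (Set.range φ)ᶜ)).Nonempty ∨
      ∃ Φ : (⟨Metric.ball (0 : E4) r', Metric.isOpen_ball⟩ : TopologicalSpace.Opens E4) → 𝒟.carrier,
        𝒟.toSpacetime.IsLateChart (Minkowski.backgroundOn
          (⟨Metric.ball (0 : E4) r', Metric.isOpen_ball⟩ : TopologicalSpace.Opens E4)) Set.univ (-r') Φ ∧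
        (∃ x : (⟨Metric.ball (0 : E4) r', Metric.isOpen_ball⟩ : TopologicalSpace.Opens E4),
          (x : E4) = 0 ∧ Φ x = q) ∧
        supCkENorm ((⟨Metric.ball (0 : E4) r', Metric.isOpen_ball⟩ : TopologicalSpace.Opens E4) : Set E4) 3
          (𝒟.toSpacetime.deviationExtend (Minkowski.backgroundOn
            (⟨Metric.ball (0 : E4) r', Metric.isOpen_ball⟩ : TopologicalSpace.Opens E4)) Φ) ≤ (Λ : ℝ≥0∞) ∧
        supCkENorm ((⟨Metric.ball (0 : E4) r', Metric.isOpen_ball⟩ : TopologicalSpace.Opens E4) : Set E4) 0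
          (𝒟.toSpacetime.deviationExtend (Minkowski.backgroundOn
            (⟨Metric.ball (0 : E4) r', Metric.isOpen_ball⟩ : TopologicalSpace.Opens E4)) Φ) ≤ 1 / 2 := by
  classical
  -- abbreviations
  set ιK : Set 𝒟.carrier := 𝒟.embed '' (Set.range φ)ᶜ with hιK
  set JK := 𝒟.metric.causalFuture 𝒟.timeOrientation ιK with hJK
  set JX := 𝒟.metric.causalFuture 𝒟.timeOrientation (Set.range 𝒟.embed) with hJX
  by_cases hA : (γ '' (dom ∩ Set.Ici 0) ∩ JK).Nonempty
  · exact Or.inl hA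
  right
  have hB : ∀ t ∈ dom, 0 ≤ t → γ t ∉ JK := fun t ht h0 hmem ↦
    hA ⟨γ t, ⟨t, ⟨ht, h0⟩, rfl⟩, hmem⟩
  have hn1 : (1 : ℕ∞ω) ≤ ((⊤ : ℕ∞) : WithTop ℕ∞) := by exact_mod_cast le_top
  -- the ray: a future causal geodesic on `dom ⊇ [0, ∞)`
  obtain ⟨hIci, hcausal, hvel⟩ := normalisedNullRay_future_half 𝒟 hray hdom
  have hgeo : IsGeodesicOn 𝒟.metric.leviCivita γ dom := hray.1.isGeodesicOn
  have hγ0 : γ 0 = 𝒟.embed p := hray.2.2.1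
  -- a parameter `t₁ > 0` with `q ≪ γ t₁`
  obtain ⟨t₁, ht₁, hqt₁⟩ : ∃ t₁ : ℝ, 0 < t₁ ∧
      γ t₁ ∈ 𝒟.metric.chronologicalFuture 𝒟.timeOrientation {q} := by
    rw [LorentzianMetric.chronologicalPast, LorentzianMetric.chronologicalFuture_eq_biUnion] at hqI
    simp only [mem_iUnion, exists_prop] at hqI
    obtain ⟨m, ⟨t, ⟨htdom, ht0⟩, rfl⟩, hqm⟩ := hqI
    have h1 : γ t ∈ 𝒟.metric.chronologicalFuture 𝒟.timeOrientation {q} :=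
      LorentzianMetric.mem_chronologicalFuture_of_mem_chronologicalPast hqm
    have h2 : γ (t + 1) ∈ 𝒟.metric.causalFuture 𝒟.timeOrientation {γ t} :=
      IsFutureCausalCurveOn.apply_mem_causalFuture 𝒟.timeOrientation (by linarith)
        (hcausal.mono fun s hs ↦ hIci s ((mem_Ici.1 ht0).trans hs.1))
    exact ⟨t + 1, by linarith [mem_Ici.1 ht0],
      mem_chronologicalFuture_of_mem_causalFuture_of_mem_chronologicalFuture
        𝒟.timeOrientation hn1 h1 h2⟩
  have ht₁dom : t₁ ∈ dom := hIci t₁ ht₁.le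
  -- `q ∈ E`, and `γ t ∈ E` for `t ≥ 0`
  have hqK : q ∉ JK := fun hqK ↦ hB t₁ ht₁dom ht₁.le
    (causalFuture_singleton_subset_swallowed 𝒟 (Set.range φ)ᶜ hqK
      (LorentzianMetric.chronologicalFuture_subset_causalFuture _ _ _ hqt₁))
  have hqE : q ∈ JX \ JK := ⟨hq, hqK⟩
  have hγE : ∀ t : ℝ, 0 ≤ t → γ t ∈ JX \ JK := fun t ht ↦ by
    refine ⟨?_, hB t (hIci t ht) ht⟩
    have h : γ t ∈ 𝒟.metric.causalFuture 𝒟.timeOrientation {γ 0} :=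
      IsFutureCausalCurveOn.apply_mem_causalFuture 𝒟.timeOrientation ht
        (hcausal.mono fun s hs ↦ hIci s hs.1)
    exact LorentzianMetric.causalFuture_mono
      (singleton_subset_iff.2 (show γ 0 ∈ Set.range 𝒟.embed from ⟨p, hγ0.symm⟩)) h
  -- Kerr-side data of the chart `χ`
  have hχg' : ∀ p ∈ E', (∀ v w, (Kerr.spacetime M a (Kerr.rMinus M a) hM).metric.val (χ p) (mfderiv (𝓡 4) (𝓡 4) χ p v)
      (mfderiv (𝓡 4) (𝓡 4) χ p w) = 𝒟.metric.val p v w) ∧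
      (Kerr.spacetime M a (Kerr.rMinus M a) hM).timeOrientation.IsFutureDirected
        (mfderiv (𝓡 4) (𝓡 4) χ p (𝒟.timeOrientation.vectorField p)) := hχg
  -- (1) `r(χ (γ t₁)) ≥ r₊` by (F4a) applied to the Kerr geodesic `χ ∘ γ` on `(0, ∞)`
  have hrplus : Kerr.rPlus M a ≤ Kerr.radius a (χ (γ t₁) : E4) := by
    have hsub : ∀ t ∈ Set.Ioi (0 : ℝ), γ t ∈ E' := fun t ht ↦ hEE' (hγE t (le_of_lt ht))
    have hgeoK : IsGeodesicOn (Kerr.spacetime M a (Kerr.rMinus M a) hM).metric.leviCivita (χ ∘ γ) (Set.Ioi 0) :=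
      isGeodesicOn_comp_of_chart (𝓢 := 𝒟.toSpacetime) (𝓣 := (Kerr.spacetime M a (Kerr.rMinus M a) hM)) hE'o hχs
        (fun p hp ↦ (hχg' p hp).1) isOpen_Ioi (hgeo.mono fun t ht ↦ hIci t (le_of_lt ht)) hsub
    obtain ⟨hcK, -⟩ := isFutureCausalCurveOn_comp_of_chart (𝓢 := 𝒟.toSpacetime)
      (𝓣 := (Kerr.spacetime M a (Kerr.rMinus M a) hM))
      hE'o hχs hχg' (hcausal.mono fun t ht ↦ hIci t (le_of_lt ht)) hsub
    have ht₁' : t₁ ∈ Set.Ioi (0 : ℝ) := ht₁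
    have hnullK : (Kerr.spacetime M a (Kerr.rMinus M a) hM).metric.IsNull
        (velocity (𝓡 4) (χ ∘ γ) t₁) := by
      refine ⟨?_, (hcK t₁ ht₁').2.1.2⟩
      have key := val_velocity_comp_of_chart (𝓢 := 𝒟.toSpacetime)
        (𝓣 := (Kerr.spacetime M a (Kerr.rMinus M a) hM)) hE'o hχs hχg'
        (hcausal.mono fun t ht ↦ hIci t (le_of_lt ht)) hsub ht₁'
      exact key.trans (hvel t₁ ht₁dom).1.1
    exact hF4a (χ ∘ γ) 0 t₁ ht₁ hgeoK hnullK (hcK t₁ ht₁').2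
  -- (2) `χ q` lies in the causal future of the leaf in the Kerr chart
  have hleaf : ∀ y : Kerr.slice a r₁, χ (𝒟.embed (φ y)) ∈
      {z : Kerr.region a (Kerr.rMinus M a) |
        r₁ < Kerr.radius a (z : E4) ∧ (z : E4) 0 = T (Kerr.radius a (z : E4))} := by
    intro y
    have h := (hχW (ψ y) (hψC y)).2
    rw [hχ'ψ y] at h
    simp only [mem_setOf_eq, h]
    exact ⟨hψr y, hψT y⟩
  have hxJ : χ q ∈ (Kerr.spacetime M a (Kerr.rMinus M a) hM).metric.causalFuture (Kerr.spacetime M a (Kerr.rMinus M a) hM).timeOrientation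
      {z : Kerr.region a (Kerr.rMinus M a) |
        r₁ < Kerr.radius a (z : E4) ∧ (z : E4) 0 = T (Kerr.radius a (z : E4))} := by
    rcases hq with hq0 | ⟨p₀, ⟨x₀, rfl⟩, σ, a', b', hab, hσ, hσa, hσb⟩
    · obtain ⟨x₀, rfl⟩ := hq0
      by_cases hx₀ : x₀ ∈ Set.range φ
      · obtain ⟨y, rfl⟩ := hx₀
        exact LorentzianMetric.subset_causalFuture (Kerr.spacetime M a (Kerr.rMinus M a) hM).metric
          (Kerr.spacetime M a (Kerr.rMinus M a) hM).timeOrientation _ (hleaf y)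
      · exact absurd (LorentzianMetric.subset_causalFuture 𝒟.metric 𝒟.timeOrientation _
          (show 𝒟.embed x₀ ∈ ιK from ⟨x₀, hx₀, rfl⟩)) hqK
    · by_cases hx₀ : x₀ ∈ Set.range φ
      · obtain ⟨y, rfl⟩ := hx₀
        have hσE : ∀ t ∈ Icc a' b', σ t ∈ E' := fun t ht ↦ hEE'
          (curve_mem_exactPart 𝒟 hσ
            (hσa ▸ LorentzianMetric.subset_causalFuture 𝒟.metric 𝒟.timeOrientation _
              (show 𝒟.embed (φ y) ∈ Set.range 𝒟.embed from ⟨φ y, rfl⟩)) (hσb ▸ hqK) ht)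
        have h := mem_causalFuture_comp_of_chart (𝓢 := 𝒟.toSpacetime)
          (𝓣 := (Kerr.spacetime M a (Kerr.rMinus M a) hM)) hE'o hχs hχg' hab hσ hσE
        rw [hσa, hσb] at h
        exact LorentzianMetric.causalFuture_mono
          (g := (Kerr.spacetime M a (Kerr.rMinus M a) hM).metric)
          (τ := (Kerr.spacetime M a (Kerr.rMinus M a) hM).timeOrientation)
          (singleton_subset_iff.2 (hleaf y)) h
      · refine absurd ?_ hqK
        exact Or.inr ⟨𝒟.embed x₀, ⟨x₀, hx₀, rfl⟩, σ, a', b', hab, hσ, hσa, hσb⟩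
  -- (3) `χ (γ t₁) ∈ I⁺(χ q)` in the Kerr chart
  have hzI : χ (γ t₁) ∈ (Kerr.spacetime M a (Kerr.rMinus M a) hM).metric.chronologicalFuture (Kerr.spacetime M a (Kerr.rMinus M a) hM).timeOrientation {χ q} := by
    obtain ⟨q', hq', σ, a', b', hab, hσ, hσa, hσb⟩ := hqt₁
    rw [mem_singleton_iff] at hq'
    subst hq'
    have hσE : ∀ t ∈ Icc a' b', σ t ∈ E' := fun t ht ↦ hEE'
      (curve_mem_exactPart 𝒟 hσ.isFutureCausalCurveOn (hσa ▸ hqE.1)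
        (hσb ▸ hB t₁ ht₁dom ht₁.le) ht)
    have h := mem_chronologicalFuture_comp_of_chart (𝓢 := 𝒟.toSpacetime)
      (𝓣 := (Kerr.spacetime M a (Kerr.rMinus M a) hM)) hE'o hχs hχg' hab hσ hσE
    rw [hσa, hσb] at h
    exact h
  -- (4) the frame from (F4), (5) the chart
  obtain ⟨A, hAball, hC3, hC0⟩ := hF4 (χ q) (χ (γ t₁)) hxJ hzI hrplus
  have hA : ∀ y ∈ Metric.ball (0 : E4) r', max r₁ 0 < Kerr.radius a ((χ q : E4) + A y) :=
    fun y hy ↦ (hAball y hy).1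
  have hAC : ∀ y (hy : y ∈ Metric.ball (0 : E4) r'),
      (⟨(χ q : E4) + A y, Kerr.mem_region.2 (hA y hy)⟩ : Kerr.region a r₁) ∈
        {x : Kerr.region a r₁ |
          0 < (x : E4) 0 - T (Kerr.radius a (x : E4)) + (Kerr.radius a (x : E4) - r₁) / 4} :=
    fun y hy ↦ (hAball y hy).2
  obtain ⟨Φ, hΦ, hΦval, hdev⟩ := exists_lateChart_of_frame 𝒟.toSpacetime hCo hχ's hχ'o
    (fun z hz v w ↦ hχ'g z hz v w) (χ q : E4) A hA hAC
  refine ⟨Φ, hΦ, ⟨⟨0, Metric.mem_ball_self hr'⟩, rfl, ?_⟩, ?_, ?_⟩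
  · -- the centre: `Φ 0 = χ' (χ q) = q` by injectivity of `χ` on `E'`
    rw [hΦval]
    have h0 : (0 : E4) ∈ Metric.ball (0 : E4) r' := Metric.mem_ball_self hr'
    set x₀ : Kerr.region a r₁ := ⟨(χ q : E4) + A ((⟨0, h0⟩ :
      (⟨Metric.ball (0 : E4) r', Metric.isOpen_ball⟩ : TopologicalSpace.Opens E4)) : E4),
      Kerr.mem_region.2 (hA _ h0)⟩ with hx₀
    have hx₀C : 0 < (x₀ : E4) 0 - T (Kerr.radius a (x₀ : E4)) +
        (Kerr.radius a (x₀ : E4) - r₁) / 4 := hAC 0 h0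
    obtain ⟨hx₀E, hχx₀⟩ := hχW x₀ hx₀C
    refine hχi hx₀E (hEE' hqE) (Subtype.ext ?_)
    rw [hχx₀]
    show (χ q : E4) + A (0 : E4) = (χ q : E4)
    rw [map_zero, add_zero]
  · rw [hdev]; exact hC3
  · rw [hdev]; exact hC0

end Visible

end Summit.FinalStateConjecture.FinalStateConjecture.Theorems.PhotonSphereChannels.TameCensorshipCrush

end
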